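import Mathlib
import Summits.ResolutionOfSingularities.ResolutionOfSingularities.Theorems.RadicialJungCleanModelsLens5ArcPotentialCore
import Summits.ResolutionOfSingularities.ResolutionOfSingularities.Theorems.RadicialJungCleanModelsCleanLU3ArcPackage
import HarnessLib

/-!
# Route `RadicialJung`, crux `CleanModels` (stmt-15917): THEOREM P (res-B-lens-5 g7), part 3 — from the exits to the conclusion, and the
# main theorem `arcPotential` (PORT of `Cruxes/DescentPerfectToAll/Lens5_ArcPotential.lean`, 66960002e3bd; author res-B-lens-5 g7)

Line `Sketch` rev 22 of crux stmt-ResolutionOfSingularities-15917; lead `res-B-lead-1` g3 re-homes the file.  OURS; nothing here proves resolution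
in characteristic `p`.  `arcPotential`: the rev-18 data of `stub_cleanLU3Defect` + `O` discrete rank one + a derivation of `K` moving `g₀` and
preserving `A` up to a denominator ⟹ the stub conclusion — NO hypothesis on residue fields or residue tower.  Corollary: the registered
stub `stub_cleanLU3DefectArcImperfect` of `Lines/Sketch.lean` rev 22 (its extra hypotheses `¬ PerfectField k`, «residues not perfect», «residue
tower not finite» are not needed).  The lead inlined the author's `def ArcConcl` / `structure CoreHyp`, so the port is definition-free.
-/

noncomputable section

set_option linter.dupNamespace false -- mandated namespace of this single-conjunct summit
set_option linter.unusedSectionVars false -- ported file: section variables shared across the author's bricks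

open IsLocalRing
open Literature.AlgebraicGeometry.Resolution
open Summit.ResolutionOfSingularities.ResolutionOfSingularities.Theorems.RadicialJung.CleanModels

namespace Summit.ResolutionOfSingularities.ResolutionOfSingularities.Theorems.RadicialJung.CleanModels.Lens5.ArcPotentialProof

variable {K : Type} [Field K]


/-! ## From the exits to the conclusion of the stub -/

section Conclusion

variable {k : Type} [Field k] [Algebra k K]

/-- Exit (3) ⇒ conclusion (this is ✓ `conclusion_of_core`). -/
theorem concl_of_exit3 {p : ℕ} [hp : Fact p.Prime] [CharP K p] {O : ValuationSubring K} {A A' : Subalgebra k K}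
    (hA'O : A'.toSubring ≤ O.toSubring) (hAA' : A ≤ A') (hA'fg : A'.FG)
    (Rn : Subring K) [IsLocalRing Rn] (hreg : IsRegularLocalRing Rn) (hRn : Rn = locAtCentre A'.toSubring O)
    (g₀ b c π : K) (hb : b ≠ 0) (hπ0 : π ≠ 0) (m' : ℕ)
    (G : Rn) (hGm : G ∈ maximalIdeal Rn) (hGm2 : G ∉ maximalIdeal Rn ^ 2) (hG : (G : K) = (b ^ p * g₀ - c ^ p) / π ^ (p * m')) :
    (∃ (A' : Subalgebra k K), A'.toSubring ≤ O.toSubring ∧ A ≤ A' ∧ A'.FG ∧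
      ∃ (_ : IsRegularLocalRing (locAtCentre A'.toSubring O)) (c : Fin p → K), (∃ j : Fin p, (j : ℕ) ≠ 0 ∧ c j ≠ 0) ∧
      ((∃ (d m : ℕ) (hmd : m ≤ d) (t : Fin d → ↥(locAtCentre A'.toSubring O)) (a : Fin m → ℕ) (u : ↥(locAtCentre A'.toSubring O)), IsUnit u ∧
      Ideal.span (Set.range t) = IsLocalRing.maximalIdeal ↥(locAtCentre A'.toSubring O) ∧
      ringKrullDim ↥(locAtCentre A'.toSubring O) = (d : WithBot ℕ∞) ∧ 0 < m ∧ (∀ i, ¬ p ∣ a i) ∧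
      (∑ j : Fin p, c j ^ p * g₀ ^ (j : ℕ)) = (u : K) * ∏ i : Fin m, ((t (Fin.castLE hmd i) : ↥(locAtCentre A'.toSubring O)) : K) ^ (a i)) ∨
      (∃ u : ↥(locAtCentre A'.toSubring O), IsUnit u ∧ (∑ j : Fin p, c j ^ p * g₀ ^ (j : ℕ)) = (u : K) ∧
      ∀ c' : ↥(locAtCentre A'.toSubring O), u - c' ^ p ∉ IsLocalRing.maximalIdeal ↥(locAtCentre A'.toSubring O)) ∨
      (∃ s c' : ↥(locAtCentre A'.toSubring O), (∑ j : Fin p, c j ^ p * g₀ ^ (j : ℕ)) = (s : K) ∧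
      s - c' ^ p ∈ IsLocalRing.maximalIdeal ↥(locAtCentre A'.toSubring O) ∧
      s - c' ^ p ∉ IsLocalRing.maximalIdeal ↥(locAtCentre A'.toSubring O) ^ 2))) :=
  conclusion_of_core hA'O hAA' hA'fg Rn hreg hRn g₀ b c π hb hπ0 m' G hGm hGm2 hG

/-- Exit (2) ⇒ conclusion. [folklore] -/
theorem concl_of_exit2 {p : ℕ} [hp : Fact p.Prime] [CharP K p] {O : ValuationSubring K} {A A' : Subalgebra k K}
    (hA'O : A'.toSubring ≤ O.toSubring) (hAA' : A ≤ A') (hA'fg : A'.FG)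
    (Rn : Subring K) [IsLocalRing Rn] (hreg : IsRegularLocalRing Rn) (hRn : Rn = locAtCentre A'.toSubring O)
    (g₀ b c π : K) (hb : b ≠ 0) (hπ0 : π ≠ 0) (m' : ℕ)
    (U : Rn) (hU : IsUnit U) (hUeq : (U : K) = (b ^ p * g₀ - c ^ p) / π ^ (p * m'))
    (hres : ∀ c' : Rn, U - c' ^ p ∉ maximalIdeal Rn) :
    (∃ (A' : Subalgebra k K), A'.toSubring ≤ O.toSubring ∧ A ≤ A' ∧ A'.FG ∧
      ∃ (_ : IsRegularLocalRing (locAtCentre A'.toSubring O)) (c : Fin p → K), (∃ j : Fin p, (j : ℕ) ≠ 0 ∧ c j ≠ 0) ∧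
      ((∃ (d m : ℕ) (hmd : m ≤ d) (t : Fin d → ↥(locAtCentre A'.toSubring O)) (a : Fin m → ℕ) (u : ↥(locAtCentre A'.toSubring O)), IsUnit u ∧
      Ideal.span (Set.range t) = IsLocalRing.maximalIdeal ↥(locAtCentre A'.toSubring O) ∧
      ringKrullDim ↥(locAtCentre A'.toSubring O) = (d : WithBot ℕ∞) ∧ 0 < m ∧ (∀ i, ¬ p ∣ a i) ∧
      (∑ j : Fin p, c j ^ p * g₀ ^ (j : ℕ)) = (u : K) * ∏ i : Fin m, ((t (Fin.castLE hmd i) : ↥(locAtCentre A'.toSubring O)) : K) ^ (a i)) ∨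
      (∃ u : ↥(locAtCentre A'.toSubring O), IsUnit u ∧ (∑ j : Fin p, c j ^ p * g₀ ^ (j : ℕ)) = (u : K) ∧
      ∀ c' : ↥(locAtCentre A'.toSubring O), u - c' ^ p ∉ IsLocalRing.maximalIdeal ↥(locAtCentre A'.toSubring O)) ∨
      (∃ s c' : ↥(locAtCentre A'.toSubring O), (∑ j : Fin p, c j ^ p * g₀ ^ (j : ℕ)) = (s : K) ∧
      s - c' ^ p ∈ IsLocalRing.maximalIdeal ↥(locAtCentre A'.toSubring O) ∧
      s - c' ^ p ∉ IsLocalRing.maximalIdeal ↥(locAtCentre A'.toSubring O) ^ 2))) := by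
  subst hRn
  refine ⟨A', hA'O, hAA', hA'fg, hreg,
    fun j : Fin p => if (j : ℕ) = 0 then -c / π ^ m' else if (j : ℕ) = 1 then b / π ^ m' else 0, ?_, ?_⟩
  · refine ⟨⟨1, hp.out.one_lt⟩, one_ne_zero, ?_⟩
    simp only [one_ne_zero, if_false, if_true]
    exact div_ne_zero hb (pow_ne_zero _ hπ0)
  · refine Or.inr (Or.inl ⟨U, hU, ?_, hres⟩)
    rw [sum_rep_eq, hUeq]

/-- Exit (1) ⇒ conclusion: the monomial `π^r F` with `(π, F, t₃)` a regular system of parameters, `0 < r < p`. [folklore] -/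
theorem concl_of_exit1 {p : ℕ} [hp : Fact p.Prime] [CharP K p] {O : ValuationSubring K} {A A' : Subalgebra k K}
    (hA'O : A'.toSubring ≤ O.toSubring) (hAA' : A ≤ A') (hA'fg : A'.FG)
    (Rn : Subring K) [IsLocalRing Rn] (hreg : IsRegularLocalRing Rn) (hRn : Rn = locAtCentre A'.toSubring O)
    (hdimRn : ringKrullDim Rn = 3)
    (g₀ b c π : K) (hb : b ≠ 0) (hπ0 : π ≠ 0) (m' r : ℕ) (hr0 : 0 < r) (hrp : r < p)
    (hπn : π ∈ Rn) (F t₃ : Rn) (hm : maximalIdeal Rn = Ideal.span {⟨π, hπn⟩, F, t₃})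
    (heq : (b ^ p * g₀ - c ^ p) / π ^ (p * m') = π ^ r * (F : K)) :
    (∃ (A' : Subalgebra k K), A'.toSubring ≤ O.toSubring ∧ A ≤ A' ∧ A'.FG ∧
      ∃ (_ : IsRegularLocalRing (locAtCentre A'.toSubring O)) (c : Fin p → K), (∃ j : Fin p, (j : ℕ) ≠ 0 ∧ c j ≠ 0) ∧
      ((∃ (d m : ℕ) (hmd : m ≤ d) (t : Fin d → ↥(locAtCentre A'.toSubring O)) (a : Fin m → ℕ) (u : ↥(locAtCentre A'.toSubring O)), IsUnit u ∧
      Ideal.span (Set.range t) = IsLocalRing.maximalIdeal ↥(locAtCentre A'.toSubring O) ∧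
      ringKrullDim ↥(locAtCentre A'.toSubring O) = (d : WithBot ℕ∞) ∧ 0 < m ∧ (∀ i, ¬ p ∣ a i) ∧
      (∑ j : Fin p, c j ^ p * g₀ ^ (j : ℕ)) = (u : K) * ∏ i : Fin m, ((t (Fin.castLE hmd i) : ↥(locAtCentre A'.toSubring O)) : K) ^ (a i)) ∨
      (∃ u : ↥(locAtCentre A'.toSubring O), IsUnit u ∧ (∑ j : Fin p, c j ^ p * g₀ ^ (j : ℕ)) = (u : K) ∧
      ∀ c' : ↥(locAtCentre A'.toSubring O), u - c' ^ p ∉ IsLocalRing.maximalIdeal ↥(locAtCentre A'.toSubring O)) ∨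
      (∃ s c' : ↥(locAtCentre A'.toSubring O), (∑ j : Fin p, c j ^ p * g₀ ^ (j : ℕ)) = (s : K) ∧
      s - c' ^ p ∈ IsLocalRing.maximalIdeal ↥(locAtCentre A'.toSubring O) ∧
      s - c' ^ p ∉ IsLocalRing.maximalIdeal ↥(locAtCentre A'.toSubring O) ^ 2))) := by
  subst hRn
  refine ⟨A', hA'O, hAA', hA'fg, hreg,
    fun j : Fin p => if (j : ℕ) = 0 then -c / π ^ m' else if (j : ℕ) = 1 then b / π ^ m' else 0, ?_, ?_⟩
  · refine ⟨⟨1, hp.out.one_lt⟩, one_ne_zero, ?_⟩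
    simp only [one_ne_zero, if_false, if_true]
    exact div_ne_zero hb (pow_ne_zero _ hπ0)
  · refine Or.inl ⟨3, 2, by norm_num, ![⟨π, hπn⟩, F, t₃], ![r, 1], 1, isUnit_one, ?_, ?_, by norm_num, ?_, ?_⟩
    · rw [hm]
      congr 1
      ext t
      simp only [Set.mem_range, Set.mem_insert_iff, Set.mem_singleton_iff]
      constructor
      · rintro ⟨i, rfl⟩
        fin_cases i <;> simp
      · rintro (rfl | rfl | rfl)
        · exact ⟨0, rfl⟩
        · exact ⟨1, rfl⟩
        · exact ⟨2, rfl⟩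
    · rw [hdimRn]; rfl
    · intro i
      fin_cases i
      · exact Nat.not_dvd_of_pos_of_lt hr0 hrp
      · exact hp.out.not_dvd_one
    · rw [sum_rep_eq, heq, Fin.prod_univ_two, Subring.coe_one, one_mul]
      change π ^ r * (F : K) = ((⟨π, hπn⟩ : ↥(locAtCentre A'.toSubring O)) : K) ^ r * (F : K) ^ 1
      rw [pow_one]

end Conclusion

/-! ## THEOREM P -/

section Main

variable {k : Type} [Field k] [Algebra k K]

/-- **THEOREM P** (memo e709ae1b8c5f §2): class (A) — discrete rank-one `O`, `g₀` with no best `p`-th-power approximation, a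
derivation moving `g₀` with bounded denominators on `A` — has clean local uniformization in loose clean form, for EVERY residue
tower and EVERY ground field.  (= ✓ `cleanLU3Defect_of_discrete_of_finiteResidue` without its finite-residue hypothesis; `htd`,
`hdimA` unused.) [folklore] -/
theorem arcPotential (p : ℕ) (hp : p.Prime) (k : Type) [Field k] [CharP k p] (K : Type) [Field K] [Algebra k K]
    (O : ValuationSubring K) (A : Subalgebra k K) (hAO : A.toSubring ≤ O.toSubring) (hAfg : A.FG)
    (hfrac : IsFractionRing A K) (_hdimA : ringKrullDim A ≤ 3) (hreg : IsRegularLocalRing (locAtCentre A.toSubring O))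
    (hdim3 : ringKrullDim (locAtCentre A.toSubring O) = 3)
    (hzd : ∀ (T : Subring K) (hT : T ≤ O.toSubring), A.toSubring ≤ T → (subringCentre T O hT).IsMaximal)
    (g₀ : K) (hg₀ : ∀ c : K, c ^ p ≠ g₀)
    (hdefect : ∀ f₀ : K, ∃ f₁ : K, O.valuation (g₀ - f₁ ^ p) < O.valuation (g₀ - f₀ ^ p))
    (_htd : ∀ hk : ∀ c : k, algebraMap k K c ∈ O, transcendenceDefect k O hk ≠ 0)
    (hdisc : ∃ π : K, π ≠ 0 ∧ (∀ x : K, O.valuation x < 1 → O.valuation x ≤ O.valuation π) ∧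
      (∀ x : K, x ≠ 0 → ∃ n : ℕ, O.valuation π ^ n ≤ O.valuation x))
    (hDer : ∃ (D : Derivation ℤ K K) (s : K), s ≠ 0 ∧ (∀ y : K, y ∈ A → s * D y ∈ A) ∧ D g₀ ≠ 0) :
    (∃ (A' : Subalgebra k K), A'.toSubring ≤ O.toSubring ∧ A ≤ A' ∧ A'.FG ∧
      ∃ (_ : IsRegularLocalRing (locAtCentre A'.toSubring O)) (c : Fin p → K), (∃ j : Fin p, (j : ℕ) ≠ 0 ∧ c j ≠ 0) ∧
      ((∃ (d m : ℕ) (hmd : m ≤ d) (t : Fin d → ↥(locAtCentre A'.toSubring O)) (a : Fin m → ℕ) (u : ↥(locAtCentre A'.toSubring O)), IsUnit u ∧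
      Ideal.span (Set.range t) = IsLocalRing.maximalIdeal ↥(locAtCentre A'.toSubring O) ∧
      ringKrullDim ↥(locAtCentre A'.toSubring O) = (d : WithBot ℕ∞) ∧ 0 < m ∧ (∀ i, ¬ p ∣ a i) ∧
      (∑ j : Fin p, c j ^ p * g₀ ^ (j : ℕ)) = (u : K) * ∏ i : Fin m, ((t (Fin.castLE hmd i) : ↥(locAtCentre A'.toSubring O)) : K) ^ (a i)) ∨
      (∃ u : ↥(locAtCentre A'.toSubring O), IsUnit u ∧ (∑ j : Fin p, c j ^ p * g₀ ^ (j : ℕ)) = (u : K) ∧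
      ∀ c' : ↥(locAtCentre A'.toSubring O), u - c' ^ p ∉ IsLocalRing.maximalIdeal ↥(locAtCentre A'.toSubring O)) ∨
      (∃ s c' : ↥(locAtCentre A'.toSubring O), (∑ j : Fin p, c j ^ p * g₀ ^ (j : ℕ)) = (s : K) ∧
      s - c' ^ p ∈ IsLocalRing.maximalIdeal ↥(locAtCentre A'.toSubring O) ∧
      s - c' ^ p ∉ IsLocalRing.maximalIdeal ↥(locAtCentre A'.toSubring O) ^ 2))) := by
  obtain ⟨π, hπ0, hπ, harch⟩ := hdisc
  obtain ⟨D, s, hs0, hDA, hDg⟩ := hDer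
  classical
  haveI : Fact p.Prime := ⟨hp⟩
  haveI : CharP K p := charP_of_injective_algebraMap (algebraMap k K).injective p
  -- (0) the quadratic sequence package
  have hd : ringKrullDim (locAtCentre A.toSubring O) ≠ 0 := by
    intro h0; rw [hdim3] at h0; exact absurd h0 (by decide)
  obtain ⟨R, hR0, hstep, hregR, hdimR, hmodel⟩ := exists_quadraticSeq_package A O hAO hAfg hreg hd hzd
  haveI hRloc : ∀ i, IsLocalRing (R i) := fun i => by haveI := hregR i; infer_instance
  have h0dom : SubringDominates (R 0) O.toSubring := by rw [hR0]; exact subringDominates_locAtCentre hAO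
  have hdom : ∀ i, SubringDominates (R i) O.toSubring := fun i => (sequence_dominates h0dom hstep i).1
  have hmono : ∀ {i j : ℕ}, i ≤ j → R i ≤ R j := fun hij => sequence_monotone hstep hij
  have hof : IsLocalRingOf (R 0) := by rw [hR0]; exact isLocalRingOf_locAtCentre A O hAO
  have hdim3R : ∀ i, ringKrullDim (R i) = 3 := fun i => (hdimR i).trans hdim3
  have hAR0 : A.toSubring ≤ R 0 := by rw [hR0]; exact le_locAtCentre _ O
  have hmemR : ∀ i (a : R i), a ∈ maximalIdeal (R i) ↔ O.valuation (a : K) < 1 := fun i =>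
    (subringDominates_valuationSubring_iff (hdom i).1).mp (hdom i)
  -- (1) `h = b^p g₀ ∈ A`
  obtain ⟨a, b, hb, hab⟩ := IsFractionRing.div_surjective (A := A) g₀
  have hab' : (a : K) / (b : K) = g₀ := hab
  have hb0 : (b : K) ≠ 0 := fun h => nonZeroDivisors.ne_zero hb (Subtype.ext h)
  set h : K := (b : K) ^ p * g₀ with hhdef
  have hhA : h ∈ A := by
    have : h = (a : K) * (b : K) ^ (p - 1) := by
      obtain ⟨q, hq⟩ : ∃ q, p = q + 1 := ⟨p - 1, (Nat.sub_add_cancel hp.one_lt.le).symm⟩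
      rw [hhdef, ← hab', hq, Nat.add_sub_cancel, pow_succ]
      field_simp
    rw [this]
    exact A.mul_mem a.2 (A.pow_mem b.2 _)
  -- `v π < 1`, `π ∈ O`
  have hne0 : maximalIdeal (R 0) ≠ ⊥ := by
    intro hbot
    have hfield : IsField (R 0) := IsLocalRing.isField_iff_maximalIdeal_eq.mpr hbot
    have h0 : ringKrullDim (R 0) = 0 := ringKrullDim_eq_zero_of_isField hfield
    rw [hdim3R] at h0; exact absurd h0 (by decide)
  obtain ⟨m₀, hm₀m, hm₀0⟩ := Submodule.exists_mem_ne_zero_of_ne_bot hne0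
  have hvπ : O.valuation π < 1 := by
    have hvm : O.valuation (m₀ : K) < 1 := (hmemR 0 m₀).mp hm₀m
    have hm0' : (m₀ : K) ≠ 0 := fun h0 => hm₀0 (Subtype.ext h0)
    obtain ⟨n, hn⟩ := harch _ hm0'
    by_contra hge
    push Not at hge
    have : (1 : O.ValueGroup) ≤ O.valuation π ^ n := one_le_pow₀ hge
    exact absurd (this.trans hn) (not_le.mpr hvm)
  have hπO : π ∈ O := by rw [← O.valuation_le_one_iff]; exact hvπ.le
  have hvπpos : 0 < O.valuation π := zero_lt_iff.mpr ((Valuation.ne_zero_iff _).mpr hπ0)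
  -- (2) transport of the derivation
  have hD0 : ∀ y ∈ R 0, s * D y ∈ R 0 := by
    rw [hR0]
    exact mul_derivation_mem_locAtCentre D s (B := A.toSubring) (O := O) (fun y hy => hDA y hy)
  have hDer := exists_derivation_preserving_seq R hstep D s hs0 hD0
  -- (3) climb until `π` is absorbed
  obtain ⟨n₁, hπn₁⟩ := exists_mem_of_quadraticTransforms_of_discrete O R hof h0dom hstep π hπ harch π hπO
  -- the restarted sequence at `n₁`
  let R' : ℕ → Subring K := fun i => R (n₁ + i)
  haveI hR'loc : ∀ i, IsLocalRing (R' i) := fun i => hRloc (n₁ + i)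
  have hstep' : ∀ i, IsQuadraticTransformAlong O (R' i) (R' (i + 1)) := fun i => by
    change IsQuadraticTransformAlong O (R (n₁ + i)) (R (n₁ + (i + 1)))
    rw [← add_assoc]; exact hstep (n₁ + i)
  have h0' : SubringDominates (R' 0) O.toSubring := hdom (n₁ + 0)
  have hπR' : π ∈ R' 0 := hπn₁
  -- the derivation at stage `n₁`, `E h = π^o u`
  obtain ⟨s₁, hs₁0, hD₁⟩ := hDer n₁
  have hDh : D h = (b : K) ^ p * D g₀ := by
    rw [hhdef, Derivation.leibniz, Derivation.leibniz_pow]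
    simp [smul_eq_mul, nsmul_eq_mul]
  have hEh0 : s₁ * D h ≠ 0 := mul_ne_zero hs₁0 (by rw [hDh]; exact mul_ne_zero (pow_ne_zero _ hb0) hDg)
  have hhR : h ∈ R n₁ := hmono (Nat.zero_le n₁) (hAR0 hhA)
  have hEhR : s₁ * D h ∈ R' 0 := hD₁ h hhR
  have hEhO : s₁ * D h ∈ O := (hdom n₁).1 hEhR
  obtain ⟨o, ho⟩ := exists_valuation_eq_pow_of_discrete O π hπ harch (s₁ * D h) hEh0 hEhO
  obtain ⟨u, huR, hvu, hEu⟩ := exists_eq_pow_mul_unit R' h0' hstep' π hπR' hπ0 hvπ hπ o 0 (s₁ * D h) hEhR ho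
  rw [Nat.zero_add] at huR
  -- restart again at `n₂ := n₁ + o`
  let R'' : ℕ → Subring K := fun i => R (n₁ + o + i)
  haveI hR''loc : ∀ i, IsLocalRing (R'' i) := fun i => hRloc (n₁ + o + i)
  have hstep'' : ∀ i, IsQuadraticTransformAlong O (R'' i) (R'' (i + 1)) := fun i => by
    change IsQuadraticTransformAlong O (R (n₁ + o + i)) (R (n₁ + o + (i + 1)))
    rw [← add_assoc]; exact hstep (n₁ + o + i)
  have hder'' : ∀ y ∈ R'' 0, π ^ o * s₁ * D y ∈ R'' 0 :=
    derivation_transport_pow R' h0' hstep' π hπR' hπ0 hvπ hπ D s₁ hD₁ o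
  have hnp : ∀ c : K, c ^ p ≠ h := by
    intro c hc
    apply hg₀ (c / (b : K))
    rw [div_pow, hc, hhdef, mul_div_cancel_left₀ _ (pow_ne_zero _ hb0)]
  have hdefect' : ∀ c : K, ∃ c' : K, O.valuation (h - c' ^ p) < O.valuation (h - c ^ p) := by
    intro c
    obtain ⟨f₁, hf₁⟩ := hdefect (c / (b : K))
    refine ⟨(b : K) * f₁, ?_⟩
    have e1 : h - ((b : K) * f₁) ^ p = (b : K) ^ p * (g₀ - f₁ ^ p) := by rw [hhdef]; ring
    have e2 : h - c ^ p = (b : K) ^ p * (g₀ - (c / (b : K)) ^ p) := by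
      rw [hhdef, div_pow, mul_sub, mul_div_cancel₀ _ (pow_ne_zero _ hb0)]
    rw [e1, e2, map_mul, map_mul]
    have hbp : 0 < O.valuation ((b : K) ^ p) :=
      zero_lt_iff.mpr ((Valuation.ne_zero_iff _).mpr (pow_ne_zero _ hb0))
    by_contra hle
    push Not at hle
    exact absurd (le_of_mul_le_mul_left hle hbp) (not_le.mpr hf₁)
  have hDh' : π ^ o * s₁ * D h = π ^ (o + o) * u := by rw [mul_assoc, hEu]; ring
  have H : (∀ i, IsRegularLocalRing (R'' i)) ∧ (∀ i, ringKrullDim (R'' i) = 3) ∧ SubringDominates (R'' 0) O.toSubring ∧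
      (∀ i, IsQuadraticTransformAlong O (R'' i) (R'' (i + 1))) ∧ π ∈ R'' 0 ∧ π ≠ 0 ∧ O.valuation π < 1 ∧
      (∀ x : K, O.valuation x < 1 → O.valuation x ≤ O.valuation π) ∧
      (∀ x : K, x ≠ 0 → ∃ n : ℕ, O.valuation π ^ n ≤ O.valuation x) ∧ (∀ y ∈ R'' 0, π ^ o * s₁ * D y ∈ R'' 0) ∧ h ∈ R'' 0 ∧
      (∀ c : K, c ^ p ≠ h) ∧ (∀ c : K, ∃ c' : K, O.valuation (h - c' ^ p) < O.valuation (h - c ^ p)) ∧ u ∈ R'' 0 ∧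
      O.valuation u = 1 ∧ π ^ o * s₁ * D h = π ^ (o + o) * u :=
    ⟨fun i => hregR _, fun i => hdim3R _, hdom _, hstep'', hmono (Nat.le_add_right n₁ o) hπn₁, hπ0, hvπ, hπ, harch, hder'',
      hmono (Nat.le_add_right n₁ o) hhR, hnp, hdefect', huR, hvu, hDh'⟩
  -- run the algorithm
  obtain ⟨n, c, hexit⟩ := (CoreHyp.core H)
  obtain ⟨A', hA'O, hAA', hA'fg, hRn⟩ := hmodel (n₁ + o + n)
  have hregn : IsRegularLocalRing (R'' n) := hregR _
  rcases hexit with ⟨m', G, hGm, hGm2, hG⟩ | ⟨m', U, hU, hUeq, hres⟩ | ⟨m', r, hπn, F, t₃, hr0, hrp, hm, heq⟩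
  · exact concl_of_exit3 hA'O hAA' hA'fg (R'' n) hregn hRn g₀ (b : K) c π hb0 hπ0 m' G hGm hGm2 (by rw [hG])
  · exact concl_of_exit2 hA'O hAA' hA'fg (R'' n) hregn hRn g₀ (b : K) c π hb0 hπ0 m' U hU (by rw [hUeq]) hres
  · exact concl_of_exit1 hA'O hAA' hA'fg (R'' n) hregn hRn (hdim3R _) g₀ (b : K) c π hb0 hπ0 m' r hr0 hrp hπn F t₃ hm
      (by rw [← heq])

end Main


end Summit.ResolutionOfSingularities.ResolutionOfSingularities.Theorems.RadicialJung.CleanModels.Lens5.ArcPotentialProof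

namespace Summit.ResolutionOfSingularities.ResolutionOfSingularities.Theorems.RadicialJung.CleanModels

/-- **Registered stub `stub_cleanLU3DefectArcImperfect` of line `Sketch` rev 22** (statement VERBATIM from
`Cruxes/CleanModels/Lines/Sketch.lean`): class (A) — `O` discrete of rank one, `g₀` without best `p`-th-power approximation, a derivation
moving `g₀` and preserving `A` up to a denominator — has clean local uniformization.  Immediate from res-B-lens-5's THEOREM P
`Lens5.ArcPotentialProof.arcPotential`, which needs NEITHER the imperfectness of `k` NOR the failure of the residue hypotheses (those three
hypotheses of the registered stub are simply dropped). [folklore] -/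
theorem stub_cleanLU3DefectArcImperfect :
    ∀ (p : ℕ), p.Prime →
    ∀ (k : Type) [Field k] [CharP k p] (K : Type) [Field K] [Algebra k K]
    (O : ValuationSubring K) (A : Subalgebra k K), A.toSubring ≤ O.toSubring → A.FG → IsFractionRing A K →
    ringKrullDim A ≤ 3 → IsRegularLocalRing (locAtCentre A.toSubring O) →
    ringKrullDim (locAtCentre A.toSubring O) = 3 →
    (∀ (T : Subring K) (hT : T ≤ O.toSubring), A.toSubring ≤ T → (subringCentre T O hT).IsMaximal) →
    ∀ g₀ : K, (∀ c : K, c ^ p ≠ g₀) →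
    (∀ f₀ : K, ∃ f₁ : K, O.valuation (g₀ - f₁ ^ p) < O.valuation (g₀ - f₀ ^ p)) →
    (∀ hk : ∀ c : k, algebraMap k K c ∈ O, transcendenceDefect k O hk ≠ 0) →
    (∃ π : K, π ≠ 0 ∧ (∀ x : K, O.valuation x < 1 → O.valuation x ≤ O.valuation π) ∧
      (∀ x : K, x ≠ 0 → ∃ n : ℕ, O.valuation π ^ n ≤ O.valuation x)) →
    ¬ PerfectField k →
    (∃ (D : Derivation ℤ K K) (s : K), s ≠ 0 ∧ (∀ y : K, y ∈ A → s * D y ∈ A) ∧ D g₀ ≠ 0) →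
    ¬ (∀ (T : Subring K), T ≤ O.toSubring → A.toSubring ≤ T → ∀ r : K, r ∈ T → ∃ t : K, t ∈ T ∧ O.valuation (r - t ^ p) < 1) →
    ¬ (∃ S : Finset K, (↑S : Set K) ⊆ O ∧
      ∀ y : K, y ∈ O → ∃ r : K, r ∈ Subring.closure ((locAtCentre A.toSubring O : Set K) ∪ ↑S) ∧ O.valuation (y - r) < 1) →
    ∃ (A' : Subalgebra k K), A'.toSubring ≤ O.toSubring ∧ A ≤ A' ∧ A'.FG ∧
    ∃ (_ : IsRegularLocalRing (locAtCentre A'.toSubring O)) (c : Fin p → K), (∃ j : Fin p, (j : ℕ) ≠ 0 ∧ c j ≠ 0) ∧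
    ((∃ (d m : ℕ) (hmd : m ≤ d) (t : Fin d → ↥(locAtCentre A'.toSubring O)) (a : Fin m → ℕ) (u : ↥(locAtCentre A'.toSubring O)), IsUnit u ∧
    Ideal.span (Set.range t) = IsLocalRing.maximalIdeal ↥(locAtCentre A'.toSubring O) ∧
    ringKrullDim ↥(locAtCentre A'.toSubring O) = (d : WithBot ℕ∞) ∧ 0 < m ∧ (∀ i, ¬ p ∣ a i) ∧
    (∑ j : Fin p, c j ^ p * g₀ ^ (j : ℕ)) = (u : K) * ∏ i : Fin m, ((t (Fin.castLE hmd i) : ↥(locAtCentre A'.toSubring O)) : K) ^ (a i)) ∨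
    (∃ u : ↥(locAtCentre A'.toSubring O), IsUnit u ∧ (∑ j : Fin p, c j ^ p * g₀ ^ (j : ℕ)) = (u : K) ∧
    ∀ c' : ↥(locAtCentre A'.toSubring O), u - c' ^ p ∉ IsLocalRing.maximalIdeal ↥(locAtCentre A'.toSubring O)) ∨
    (∃ s c' : ↥(locAtCentre A'.toSubring O), (∑ j : Fin p, c j ^ p * g₀ ^ (j : ℕ)) = (s : K) ∧
    s - c' ^ p ∈ IsLocalRing.maximalIdeal ↥(locAtCentre A'.toSubring O) ∧
    s - c' ^ p ∉ IsLocalRing.maximalIdeal ↥(locAtCentre A'.toSubring O) ^ 2)) := by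
  intro p hp k _ _ K _ _ O A hAO hAfg hfrac hdimA hreg hdim3 hzd g₀ hg₀ hdefect htd hdisc _ hDer _ _
  exact Lens5.ArcPotentialProof.arcPotential p hp k K O A hAO hAfg hfrac hdimA hreg hdim3 hzd g₀ hg₀ hdefect htd hdisc hDer

end Summit.ResolutionOfSingularities.ResolutionOfSingularities.Theorems.RadicialJung.CleanModels

end
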